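import Literature.Computability.QuantumComplexity.PauliPathIntegral
import Mathlib.Analysis.SpecialFunctions.Exp
import HarnessLib

/-!
# Orthogonality of the Fourier coefficients of Pauli-framed circuits (Aharonov–Gao–Landau–Liu–Vazirani 2023, §2 Lemma 3)

Topic `Literature/Computability/QuantumComplexity`; sequel of `PauliPathIntegral.lean` (pub-qadeq lane,
rows E-01…E-10: the step of the noisy-RCS easiness argument that turns the truncation error into a
sum of squared Fourier coefficients).

HONEST FRAMING: instance-level adjudication of specific advantage claims; no claim about BQP vs
BPP or the summit. Deterministic finite identities only; nothing here is about any experiment,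
about anti-concentration, or about running times.

## Source

D. Aharonov, X. Gao, Z. Landau, Y. Liu, U. Vazirani, STOC 2023 = arXiv:2211.03999 [AharonovEtAl2023],
§2 (tex chunk p0008 of `lit read arxiv:2211.03999`):

* Definition 3 (gate set and architecture): "Each 2-qubit gate is independently drawn from some
  distribution that is invariant under right-multiplication of random Pauli. The final layer is drawn
  from a distribution that is invariant under both left- and right-multiplication of random Pauli."
  (verbatim: both sentences are the end of the single long line L22 of tex chunk p0008 — the body of
  the `definition` environment, beginning "We consider random quantum circuits defined over a fixed
  architecture"; REFEREE R-PPO-1) … "A fixed 2-qubit gate surrounded by random Pauli gates also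
  satisfies Definition 3" (p0008 L26).
* Lemma 3 (Orthogonality of Fourier coefficients): "Let `C` be a random circuit drawn from some
  distribution `𝒟` that satisfies Definition 3. Then for any Pauli paths `s ≠ s'` and for any `x`
  we have `E_{C∼𝒟}[f(C,s,x) f(C,s',x)] = 0`." Proof: "As `s ≠ s'`, there exists a 2-qubit gate `U`
  that contributes transition amplitude `⟨⟨·|𝒰|p_1⟩⟩` to `f(C,s,x)` and `⟨⟨·|𝒰|p_2⟩⟩` to `f(C,s',x)`,
  such that `p_1 ≠ p_2` … Due to the independence between different gates, we can separately
  calculate the expectation over each gate … One special case is that the difference between `s`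
  and `s'` happens at the last step `s_d`. For this case we use the left-invariance under random
  Pauli of the final layer of gates."
* §3.1, the chain bounding `E_C[Δ²]`: "the third line follows from orthogonality (Lemma 3)", i.e.
  `E_C (Σ_{s∈T} f̃(C,s,x))² = E_C Σ_{s∈T} f̃(C,s,x)²` for a set `T` of paths.

## What is formalised (the Pauli-frame ensemble of a FIXED layer sequence)

For fixed layer matrices `U_0, …, U_{d-1}` on a finite register `ι → Bool`, input `ρ`, read-out `O`
and noise rate `γ` (all as in `PauliPathIntegral.lean`), the ensemble of Definition 3's example —
every layer right-multiplied by an independent uniformly random Pauli layer `W_t`, and one more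
uniformly random Pauli layer `W_d` before the read-out (the left-randomisation of the final layer;
equivalently a twirled read-out `W_d O W_d`, since `ℰ^{⊗n}` commutes with Pauli conjugation,
`depolarizeAll_conj_pauliString`) — is the finite family
`frameLayers U W`, `frameObs O W` indexed by `W : Fin (d+1) → (ι → Pauli)`; expectations are sums
over the `(4^{|ι|})^{d+1}` frames divided by that number. We prove

* `pathCoeff_frame`: `f̃(C_W, s) = (∏_t sign_{W_t}(s_t)) · f̃(C, s)` — each frame only flips signs;
* `sum_frame_pathCoeff_mul_pathCoeff` (**Lemma 3** for this ensemble): for `s ≠ s'`,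
  `Σ_W f̃(C_W,s) f̃(C_W,s') = 0`, by the character orthogonality of `PauliPathIntegral.lean`
  applied at a step where the paths differ ("independence between different gates" = the sum over
  `W` factorises over `t`); the matched case `sum_frame_pathCoeff_sq` gives `(4^{|ι|})^{d+1} f̃(C,s)²`
  (Fourier weights are frame-invariant);
* `sum_frame_sq_sum_pathCoeff` (the §3.1 step): for every finite set `T` of paths,
  `Σ_W (Σ_{s∈T} f̃(C_W,s))² = (4^{|ι|})^{d+1} Σ_{s∈T} f̃(C,s)²`;
* the truncated estimator `truncValue γ ℓ` (`q̄(C,x) := Σ_{|s|≤ℓ} f̃(C,s,x)`, §3) and the deterministic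
  lines of the `E_C[Δ²]` chain of §3.1: `noisyValue_sub_truncValue` (second line),
  `sum_frame_sq_noisyValue_sub_truncValue` (third line, over the frame ensemble), `pathCoeff_sq_eq_pow_mul`
  (the `(1−γ)^{2|s|}`), `sq_sum_abs_le_card_mul_sum_sq` (first line, Cauchy–Schwarz) and
  `sum_pow_mul_le_pow_mul_sum` (the damping step of the "simple upper bound"); the anti-concentration
  input (Lemma 4, `Σ_k W_k = O(1)·…`) is NOT formalised;
* `pathCoeff_const_I`: the all-identity path contributes `2^{-|ι|} Tr O Tr ρ` for unitary layers
  ("`W_0 = 1` corresponds to the unique all-identity path", proof of Lemma 4).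
* Lemma 4's chain for the frame ensemble: `fourierWeight` (`W_k`, Definition 5, frame-averaged = the
  fixed circuit's), `sum_range_fourierWeight` (regrouping by degree), `sum_frame_sum_sq_noisyValue_proj`
  (`2ⁿ Σ_W Σ_x p̃_W(x)² = (4ⁿ)^{d+1} Σ_k W_k` — path integral, orthogonality, `f(C,s,x)² = f(C,s,x₀)²`);
  the anti-concentration INPUT `E 2ⁿ Σ_x p² = O(1)` itself is an assumption on the ensemble and is not
  a theorem here.
* Real form for a real rate `0 ≤ γ ≤ 1` and Hermitian `ρ`: `conj_pathCoeff_ofReal` (`f̃ ∈ ℝ`),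
  `sum_frame_norm_sq_noisyValue_sub_truncValue`, `sum_frame_norm_sq_noisyValue`, and the truncation
  error bound `sum_frame_sum_norm_sq_sub_truncValue_le`:
  `Σ_W Σ_x (p̃_W(x) − q̄_W(x))² ≤ (1−γ)^{2(ℓ+1)} Σ_W Σ_x p_W(x)²` (§3.1 chain + eq. (sumoflow)).
* `sum_frame_sum_sq_sub_truncValue_eq_sum_fourierWeight` ("the fifth line is by definition of
  Fourier weight": `2ⁿ Σ_W Σ_x (p̃_W − q̄_W)² = (4ⁿ)^{d+1} Σ_{k>ℓ} (1−γ)^{2k} W_k`) and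
  `one_sub_sq_pow_le_exp` (`(1−γ)^{2ℓ} ≤ e^{−2γℓ}`).
* `sum_frame_sq_l1_truncError_le`: with the first line (Cauchy–Schwarz) as well —
  `Σ_W (Σ_x |p̃_W(x) − q̄_W(x)|)² ≤ 2ⁿ (1−γ)^{2(ℓ+1)} Σ_W Σ_x p_W(x)²`; only the anti-concentration
  assumption separates this from the printed `E[Δ²] ≤ O(1)(1−γ)^{2ℓ}`.
* `l1TruncError` (the printed `Δ := ‖p̃ − q̄‖₁`, per frame) and the two elementary steps from `E[Δ²]`
  to "Δ ≤ ε with high probability": `avg_frame_l1TruncError_le` (Jensen: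
  `E_W[Δ_W] ≤ (1−γ)^{ℓ+1} √(2ⁿ E_W Σ_x p_W(x)²)`) and `card_frame_l1TruncError_ge_mul_sq_le` (Markov:
  `#{W : Δ_W ≥ ε}·ε² ≤ 2ⁿ (1−γ)^{2(ℓ+1)} Σ_W Σ_x p_W(x)²`), anti-concentration kept as the explicit factor.

General Definition-3 ensembles (Haar gates, …) are mixtures of such frame families by their Pauli
invariance; that measure-theoretic reduction ("Due to invariance under right-multiplication of
random Pauli and linearity, it suffices to prove …", proof of Lemma 2) is NOT formalised here.

## References

* [AharonovEtAl2023] D. Aharonov, X. Gao, Z. Landau, Y. Liu, U. Vazirani, *A polynomial-time classical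
  algorithm for noisy random circuit sampling*, STOC 2023, 945–957, arXiv:2211.03999 — §2 Definition 3,
  Lemma 3 (with proof), §3.1 (the `E_C[Δ²]` chain).
-/

noncomputable section

open Matrix Finset

namespace Literature.Computability.QuantumComplexity

namespace PauliPath

variable {ι : Type*} [Fintype ι] [DecidableEq ι]

/-! ### Pauli frames -/

/-- The sign character `sign_W(S) = ∏ᵢ sign(Wᵢ, Sᵢ) ∈ {±1}` of the conjugation `W S W = sign_W(S) S`.
[cite: AharonovEtAl2023, §2 (proof of Lemma 2: V P V† = (−1)^{⟨V,P⟩} P)] -/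
def strSign (W S : ι → Pauli) : ℂ :=
  ∏ i, Pauli.sign (W i) (S i)

omit [DecidableEq ι] in
/-- Unfolding of `strSign`. [cite: AharonovEtAl2023, §2 (proof of Lemma 2)] -/
theorem strSign_eq (W S : ι → Pauli) : strSign W S = ∏ i, Pauli.sign (W i) (S i) := rfl

/-- `W S W = sign_W(S) S`. [cite: AharonovEtAl2023, §2 (proof of Lemma 2)] -/
theorem pauliString_conj_eq_strSign_smul (W S : ι → Pauli) :
    pauliString W * pauliString S * pauliString W = strSign W S • pauliString S :=
  pauliString_conj_pauliString W S

/-- Character orthogonality in `strSign` form: `Σ_W sign_W(P) sign_W(Q) = 4^{|ι|} [P = Q]`.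
[cite: AharonovEtAl2023, §2 (proof of Lemma 2)] -/
theorem sum_strSign_mul_strSign (P Q : ι → Pauli) :
    ∑ W : ι → Pauli, strSign W P * strSign W Q = if P = Q then (4 : ℂ) ^ Fintype.card ι else 0 :=
  sum_prod_sign_mul_prod_sign P Q

/-- **`ℰ^{⊗n}` commutes with Pauli conjugation**: `ℰ^{⊗n}(W M W) = W ℰ^{⊗n}(M) W` (both sides have
Pauli coefficients `(1−γ)^{|S|} sign_W(S) Tr(S M)`); this is why a random Pauli layer before the
final noise-and-read-out is the same as a twirled read-out. [cite: AharonovEtAl2023, Definition 2 and Definition 3 (final layer)] -/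
theorem depolarizeAll_conj_pauliString (γ : ℂ) (W : ι → Pauli) (M : Matrix (ι → Bool) (ι → Bool) ℂ) :
    depolarizeAll γ (pauliString W * M * pauliString W) =
      pauliString W * depolarizeAll γ M * pauliString W := by
  refine eq_of_forall_pauliCoeff_eq fun S => ?_
  have hcyc : ∀ N : Matrix (ι → Bool) (ι → Bool) ℂ,
      pauliCoeff (pauliString W * N * pauliString W) S = strSign W S * pauliCoeff N S := by
    intro N
    rw [pauliCoeff_eq, pauliCoeff_eq, show pauliString S * (pauliString W * N * pauliString W) =
      (pauliString S * pauliString W * N) * pauliString W by simp only [Matrix.mul_assoc],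
      Matrix.trace_mul_comm, ← Matrix.mul_assoc, ← Matrix.mul_assoc,
      pauliString_conj_eq_strSign_smul, Matrix.smul_mul, Matrix.trace_smul, smul_eq_mul]
  rw [pauliCoeff_depolarizeAll, hcyc, hcyc, pauliCoeff_depolarizeAll]
  ring

/-- The layers of the Pauli-framed circuit: every layer right-multiplied by its frame string,
`U_t ↦ U_t W_t` ("a fixed 2-qubit gate surrounded by random Pauli gates").
[cite: AharonovEtAl2023, Definition 3] -/
def frameLayers {d : ℕ} (U : Fin d → Matrix (ι → Bool) (ι → Bool) ℂ)
    (W : Fin (d + 1) → ι → Pauli) : Fin d → Matrix (ι → Bool) (ι → Bool) ℂ :=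
  fun t => U t * pauliString (W t.castSucc)

/-- The read-out of the Pauli-framed circuit, conjugated by the last frame string `W_d` (the
left-randomisation of the final layer, moved through the last noise layer).
[cite: AharonovEtAl2023, Definition 3 (final layer: left- and right-invariance)] -/
def frameObs {d : ℕ} (O : Matrix (ι → Bool) (ι → Bool) ℂ) (W : Fin (d + 1) → ι → Pauli) :
    Matrix (ι → Bool) (ι → Bool) ℂ :=
  pauliString (W (Fin.last d)) * O * pauliString (W (Fin.last d))

/-- Unfolding of `frameLayers`. [cite: AharonovEtAl2023, Definition 3] -/
@[simp] theorem frameLayers_apply {d : ℕ} (U : Fin d → Matrix (ι → Bool) (ι → Bool) ℂ)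
    (W : Fin (d + 1) → ι → Pauli) (t : Fin d) :
    frameLayers U W t = U t * pauliString (W t.castSucc) := rfl

/-! ### Each frame only flips the signs of the path contributions -/

/-- A framed transition bracket: `Tr(T · (UW) ℰ^{⊗n}(S) (UW)†) = sign_W(S) Tr(T · U ℰ^{⊗n}(S) U†)`.
[cite: AharonovEtAl2023, Lemma 3 (proof: the gate "contributes transition amplitude ⟨⟨·|𝒰|p⟩⟩")] -/
theorem transAmp_mul_pauliString (γ : ℂ) (U : Matrix (ι → Bool) (ι → Bool) ℂ) (W S T : ι → Pauli) :
    transAmp γ (U * pauliString W) S T = strSign W S * transAmp γ U S T := by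
  have key : U * pauliString W * pauliString S * ((pauliString W)ᴴ * Uᴴ) =
      strSign W S • (U * pauliString S * Uᴴ) := by
    rw [conjTranspose_pauliString,
      show U * pauliString W * pauliString S * (pauliString W * Uᴴ) =
        U * (pauliString W * pauliString S * pauliString W) * Uᴴ by simp only [Matrix.mul_assoc],
      pauliString_conj_eq_strSign_smul, Matrix.mul_smul, Matrix.smul_mul]
  simp only [transAmp, depolarizeAll_pauliString, Matrix.conjTranspose_mul, Matrix.mul_smul,
    Matrix.smul_mul, key, Matrix.trace_smul, smul_eq_mul]
  ring

/-- A framed read-out bracket: `Tr(W O W · ℰ^{⊗n} S) = sign_W(S) Tr(O · ℰ^{⊗n} S)`.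
[cite: AharonovEtAl2023, Lemma 3 (proof: the special case at the last step s_d)] -/
theorem trace_frameObs_mul_depolarizeAll {d : ℕ} (γ : ℂ) (O : Matrix (ι → Bool) (ι → Bool) ℂ)
    (W : Fin (d + 1) → ι → Pauli) (S : ι → Pauli) :
    (frameObs O W * depolarizeAll γ (pauliString S)).trace =
      strSign (W (Fin.last d)) S * (O * depolarizeAll γ (pauliString S)).trace := by
  have key : (pauliString (W (Fin.last d)) * O * pauliString (W (Fin.last d)) * pauliString S).trace =
      strSign (W (Fin.last d)) S * (O * pauliString S).trace := by
    rw [Matrix.mul_assoc, Matrix.mul_assoc, Matrix.trace_mul_comm, Matrix.mul_assoc,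
      pauliString_conj_eq_strSign_smul, Matrix.mul_smul, Matrix.trace_smul, smul_eq_mul]
  rw [frameObs, depolarizeAll_pauliString, Matrix.mul_smul, Matrix.mul_smul, Matrix.trace_smul,
    Matrix.trace_smul, smul_eq_mul, smul_eq_mul, key]
  ring

/-- **Each Pauli frame only flips signs**: `f̃(C_W, s) = (∏_{t=0}^{d} sign_{W_t}(s_t)) · f̃(C, s)` — the
string `s_t` (`t < d`) meets the frame `W_t` of layer `t`, and `s_d` meets the read-out frame `W_d`.
[cite: AharonovEtAl2023, Lemma 3 (proof)] -/
theorem pathCoeff_frame (γ : ℂ) {d : ℕ} (U : Fin d → Matrix (ι → Bool) (ι → Bool) ℂ)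
    (ρ O : Matrix (ι → Bool) (ι → Bool) ℂ) (W s : Fin (d + 1) → ι → Pauli) :
    pathCoeff γ (frameLayers U W) ρ (frameObs O W) s =
      (∏ t, strSign (W t) (s t)) * pathCoeff γ U ρ O s := by
  have hprod : ∏ t : Fin d, transAmp γ (frameLayers U W t) (s t.castSucc) (s t.succ) =
      (∏ t : Fin d, strSign (W t.castSucc) (s t.castSucc)) *
        ∏ t : Fin d, transAmp γ (U t) (s t.castSucc) (s t.succ) := by
    rw [← Finset.prod_mul_distrib]
    exact Finset.prod_congr rfl fun t _ => by rw [frameLayers_apply, transAmp_mul_pauliString]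
  rw [pathCoeff, pathCoeff, trace_frameObs_mul_depolarizeAll, hprod,
    Fin.prod_univ_castSucc (fun t => strSign (W t) (s t))]
  ring

/-! ### Lemma 3: orthogonality of the Fourier coefficients over the Pauli frames -/

/-- **Lemma 3 (orthogonality of Fourier coefficients) for the Pauli-frame ensemble**: for Pauli
paths `s ≠ s'`, `Σ_W f̃(C_W,s) f̃(C_W,s') = 0` (so the expectation over a uniformly random frame
vanishes) — the sum over frames factorises over the steps ("independence between different gates")
and the step where `s_t ≠ s'_t` contributes the vanishing character sum of Lemma 2.
[cite: AharonovEtAl2023, Lemma 3] -/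
theorem sum_frame_pathCoeff_mul_pathCoeff (γ : ℂ) {d : ℕ} (U : Fin d → Matrix (ι → Bool) (ι → Bool) ℂ)
    (ρ O : Matrix (ι → Bool) (ι → Bool) ℂ) {s s' : Fin (d + 1) → ι → Pauli} (h : s ≠ s') :
    ∑ W : Fin (d + 1) → ι → Pauli,
      pathCoeff γ (frameLayers U W) ρ (frameObs O W) s *
        pathCoeff γ (frameLayers U W) ρ (frameObs O W) s' = 0 := by
  have hre : ∀ W : Fin (d + 1) → ι → Pauli,
      (∏ t, strSign (W t) (s t)) * pathCoeff γ U ρ O s *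
        ((∏ t, strSign (W t) (s' t)) * pathCoeff γ U ρ O s') =
      (∏ t, strSign (W t) (s t) * strSign (W t) (s' t)) *
        (pathCoeff γ U ρ O s * pathCoeff γ U ρ O s') := by
    intro W; rw [Finset.prod_mul_distrib]; ring
  simp only [pathCoeff_frame, hre, ← Finset.sum_mul]
  rw [← Fintype.prod_sum (fun t V => strSign V (s t) * strSign V (s' t))]
  simp only [sum_strSign_mul_strSign]
  obtain ⟨t, ht⟩ : ∃ t, s t ≠ s' t := by
    by_contra hc
    push Not at hc
    exact h (funext hc)
  rw [Finset.prod_eq_zero (Finset.mem_univ t) (if_neg ht), zero_mul]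

/-- The matched case: `Σ_W f̃(C_W,s)² = (4^{|ι|})^{d+1} f̃(C,s)²` — averaged over the frames the
squared Fourier coefficient (the path's Fourier weight) is unchanged.
[cite: AharonovEtAl2023, Lemma 3 and Definition 5 (Fourier weight)] -/
theorem sum_frame_pathCoeff_sq (γ : ℂ) {d : ℕ} (U : Fin d → Matrix (ι → Bool) (ι → Bool) ℂ)
    (ρ O : Matrix (ι → Bool) (ι → Bool) ℂ) (s : Fin (d + 1) → ι → Pauli) :
    ∑ W : Fin (d + 1) → ι → Pauli, pathCoeff γ (frameLayers U W) ρ (frameObs O W) s ^ 2 =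
      (((4 : ℂ) ^ Fintype.card ι) ^ (d + 1)) * pathCoeff γ U ρ O s ^ 2 := by
  have hre : ∀ W : Fin (d + 1) → ι → Pauli,
      ((∏ t, strSign (W t) (s t)) * pathCoeff γ U ρ O s) ^ 2 =
      (∏ t, strSign (W t) (s t) * strSign (W t) (s t)) * pathCoeff γ U ρ O s ^ 2 := by
    intro W; rw [Finset.prod_mul_distrib]; ring
  simp only [pathCoeff_frame, hre, ← Finset.sum_mul]
  rw [← Fintype.prod_sum (fun t V => strSign V (s t) * strSign V (s t))]
  simp only [sum_strSign_mul_strSign, if_true, Finset.prod_const, Finset.card_univ, Fintype.card_fin]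

/-- **The orthogonality step of §3.1** ("the third line follows from orthogonality"): for every finite
set `T` of Pauli paths (e.g. `{s : |s| > ℓ}`),
`Σ_W (Σ_{s∈T} f̃(C_W,s))² = (4^{|ι|})^{d+1} Σ_{s∈T} f̃(C,s)²` — the cross terms average out.
[cite: AharonovEtAl2023, §3.1 (the chain bounding E_C[Δ²], second to third line) and Lemma 3] -/
theorem sum_frame_sq_sum_pathCoeff (γ : ℂ) {d : ℕ} (U : Fin d → Matrix (ι → Bool) (ι → Bool) ℂ)
    (ρ O : Matrix (ι → Bool) (ι → Bool) ℂ) (T : Finset (Fin (d + 1) → ι → Pauli)) :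
    ∑ W : Fin (d + 1) → ι → Pauli, (∑ s ∈ T, pathCoeff γ (frameLayers U W) ρ (frameObs O W) s) ^ 2 =
      (((4 : ℂ) ^ Fintype.card ι) ^ (d + 1)) * ∑ s ∈ T, pathCoeff γ U ρ O s ^ 2 := by
  set c : ℂ := ((4 : ℂ) ^ Fintype.card ι) ^ (d + 1) with hc
  calc ∑ W : Fin (d + 1) → ι → Pauli,
        (∑ s ∈ T, pathCoeff γ (frameLayers U W) ρ (frameObs O W) s) ^ 2
      = ∑ W : Fin (d + 1) → ι → Pauli, ∑ s ∈ T, ∑ s' ∈ T,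
          pathCoeff γ (frameLayers U W) ρ (frameObs O W) s *
            pathCoeff γ (frameLayers U W) ρ (frameObs O W) s' := by
        simp only [sq, Finset.sum_mul_sum]
    _ = ∑ s ∈ T, ∑ s' ∈ T, ∑ W : Fin (d + 1) → ι → Pauli,
          pathCoeff γ (frameLayers U W) ρ (frameObs O W) s *
            pathCoeff γ (frameLayers U W) ρ (frameObs O W) s' := by
        rw [Finset.sum_comm]
        exact Finset.sum_congr rfl fun s _ => Finset.sum_comm
    _ = ∑ s ∈ T, ∑ s' ∈ T, (if s = s' then c * pathCoeff γ U ρ O s ^ 2 else 0) := by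
        refine Finset.sum_congr rfl fun s _ => Finset.sum_congr rfl fun s' _ => ?_
        split_ifs with h
        · subst h
          simp only [← sq]
          exact sum_frame_pathCoeff_sq γ U ρ O s
        · exact sum_frame_pathCoeff_mul_pathCoeff γ U ρ O h
    _ = c * ∑ s ∈ T, pathCoeff γ U ρ O s ^ 2 := by
        rw [Finset.mul_sum]
        refine Finset.sum_congr rfl fun s hs => ?_
        rw [Finset.sum_ite_eq, if_pos hs]

/-! ### The truncated estimator `q̄` and the deterministic lines of the `E[Δ²]` chain (§3.1) -/

/-- The low-weight truncation `q̄(C,x) := Σ_{s : |s| ≤ ℓ} f̃(C,s,x)` — "the algorithm is to approximate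
`p̃(C,x)` by summing its low-degree Fourier coefficients". [cite: AharonovEtAl2023, §3 (display defining q̄(C,x))] -/
def truncValue (γ : ℂ) (ℓ : ℕ) {d : ℕ} (U : Fin d → Matrix (ι → Bool) (ι → Bool) ℂ)
    (ρ O : Matrix (ι → Bool) (ι → Bool) ℂ) : ℂ :=
  ∑ s ∈ Finset.univ.filter (fun s : Fin (d + 1) → ι → Pauli => pathWeight s ≤ ℓ), pathCoeff γ U ρ O s

/-- "The second line is by definition of `q̄`": `p̃ − q̄ = Σ_{s : |s| > ℓ} f̃(C,s,·)`.
[cite: AharonovEtAl2023, §3.1 (E[Δ²] chain, second line)] -/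
theorem noisyValue_sub_truncValue (γ : ℂ) (ℓ : ℕ) {d : ℕ} (U : Fin d → Matrix (ι → Bool) (ι → Bool) ℂ)
    (ρ O : Matrix (ι → Bool) (ι → Bool) ℂ) :
    noisyValue γ U ρ O - truncValue γ ℓ U ρ O =
      ∑ s ∈ Finset.univ.filter (fun s : Fin (d + 1) → ι → Pauli => ¬ pathWeight s ≤ ℓ),
        pathCoeff γ U ρ O s := by
  rw [noisyValue_eq_sum_pathCoeff, truncValue, sub_eq_iff_eq_add',
    Finset.sum_filter_add_sum_filter_not]

/-- Frames do not change Hamming weights, so the truncation commutes with framing: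
`q̄` of the framed circuit is the frame-signed partial sum. [cite: AharonovEtAl2023, §3.1] -/
theorem truncValue_frame (γ : ℂ) (ℓ : ℕ) {d : ℕ} (U : Fin d → Matrix (ι → Bool) (ι → Bool) ℂ)
    (ρ O : Matrix (ι → Bool) (ι → Bool) ℂ) (W : Fin (d + 1) → ι → Pauli) :
    truncValue γ ℓ (frameLayers U W) ρ (frameObs O W) =
      ∑ s ∈ Finset.univ.filter (fun s : Fin (d + 1) → ι → Pauli => pathWeight s ≤ ℓ),
        (∏ t, strSign (W t) (s t)) * pathCoeff γ U ρ O s := by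
  simp only [truncValue, pathCoeff_frame]

/-- **"The third line follows from orthogonality"**, for the Pauli-frame ensemble: the frame-sum of the
squared truncation error is the frame count times the sum of the squared high-weight coefficients,
`Σ_W (p̃_W − q̄_W)² = (4^{|ι|})^{d+1} Σ_{|s| > ℓ} f̃(C,s,·)²`.
[cite: AharonovEtAl2023, §3.1 (E[Δ²] chain, second and third lines) and Lemma 3] -/
theorem sum_frame_sq_noisyValue_sub_truncValue (γ : ℂ) (ℓ : ℕ) {d : ℕ}
    (U : Fin d → Matrix (ι → Bool) (ι → Bool) ℂ) (ρ O : Matrix (ι → Bool) (ι → Bool) ℂ) :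
    ∑ W : Fin (d + 1) → ι → Pauli,
      (noisyValue γ (frameLayers U W) ρ (frameObs O W) - truncValue γ ℓ (frameLayers U W) ρ (frameObs O W)) ^ 2 =
      (((4 : ℂ) ^ Fintype.card ι) ^ (d + 1)) *
        ∑ s ∈ Finset.univ.filter (fun s : Fin (d + 1) → ι → Pauli => ¬ pathWeight s ≤ ℓ),
          pathCoeff γ U ρ O s ^ 2 := by
  simp only [noisyValue_sub_truncValue]
  exact sum_frame_sq_sum_pathCoeff γ U ρ O _

/-- The damping inside the squares (the `(1−γ)^{2|s|}` of the chain): `f̃(C,s,·)² = (1−γ)^{2|s|} f(C,s,·)²`.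
[cite: AharonovEtAl2023, §3.1 (E[Δ²] chain) and §2 (display after Definition 2)] -/
theorem pathCoeff_sq_eq_pow_mul (γ : ℂ) {d : ℕ} (U : Fin d → Matrix (ι → Bool) (ι → Bool) ℂ)
    (ρ O : Matrix (ι → Bool) (ι → Bool) ℂ) (s : Fin (d + 1) → ι → Pauli) :
    pathCoeff γ U ρ O s ^ 2 = ((1 - γ) ^ 2) ^ pathWeight s * pathCoeff 0 U ρ O s ^ 2 := by
  rw [pathCoeff_eq_pow_mul_pathCoeff_zero, mul_pow, ← pow_mul, ← pow_mul, mul_comm (pathWeight s) 2]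

omit [Fintype ι] [DecidableEq ι] in
/-- **"The first line follows from Cauchy–Schwarz"**: `(Σ_x |a_x|)² ≤ N · Σ_x a_x²` for a real family on
an `N`-element type (`Δ² ≤ 2ⁿ Σ_x (p̃(C,x) − q̄(C,x))²`). [cite: AharonovEtAl2023, §3.1 (E[Δ²] chain, first line)] -/
theorem sq_sum_abs_le_card_mul_sum_sq {X : Type*} [Fintype X] (a : X → ℝ) :
    (∑ x, |a x|) ^ 2 ≤ Fintype.card X * ∑ x, a x ^ 2 := by
  have h := Finset.sum_mul_sq_le_sq_mul_sq Finset.univ (fun x => |a x|) (fun _ => (1 : ℝ))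
  simp only [mul_one, one_pow, Finset.sum_const, Finset.card_univ, nsmul_eq_mul, sq_abs] at h
  linarith [h]

omit [Fintype ι] [DecidableEq ι] in
/-- The damping step of the "simple upper bound": over the high-weight paths `|s| > ℓ`, nonnegative
weights damped by `(1−γ)^{2|s|}` are at most `(1−γ)^{2(ℓ+1)}` times the undamped sum (`0 ≤ γ ≤ 1`) —
"`Σ_{k>ℓ} (1−γ)^{2k} W_k ≤ Σ_{k>ℓ} (1−γ)^{2ℓ} W_k`". [cite: AharonovEtAl2023, §3.1 (display after the chain)] -/
theorem sum_pow_mul_le_pow_mul_sum {P : Type*} (T : Finset P) (wt : P → ℕ) (w : P → ℝ)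
    (hw : ∀ s ∈ T, 0 ≤ w s) {γ : ℝ} (hγ0 : 0 ≤ γ) (hγ1 : γ ≤ 1) (ℓ : ℕ) (hT : ∀ s ∈ T, ℓ < wt s) :
    ∑ s ∈ T, ((1 - γ) ^ 2) ^ wt s * w s ≤ ((1 - γ) ^ 2) ^ (ℓ + 1) * ∑ s ∈ T, w s := by
  rw [Finset.mul_sum]
  refine Finset.sum_le_sum fun s hs => mul_le_mul_of_nonneg_right ?_ (hw s hs)
  exact pow_le_pow_of_le_one (by positivity) (by nlinarith) (hT s hs)

/-! ### The all-identity path -/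

/-- `Tr 1 = 2^{|ι|}` on the register. [folklore] -/
private theorem trace_one_reg :
    (1 : Matrix (ι → Bool) (ι → Bool) ℂ).trace = (2 : ℂ) ^ Fintype.card ι := by
  rw [Matrix.trace_one, Fintype.card_fun, Fintype.card_bool]
  push_cast
  rfl

/-- **The all-identity path** `s = (I,…,I)` (the unique path of weight `0`, "`W_0 = 1` corresponds to the
unique all-identity path"): for unitary layers its contribution is `2^{-|ι|} · Tr O · Tr ρ`, i.e. the
uniform value `1/2ⁿ` for a state `ρ` and a basis projector `O = |x⟩⟨x|`, at every noise rate.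
[cite: AharonovEtAl2023, §2 (proof of Lemma 4: "W_0 = 1 corresponds to the unique all-identity path")] -/
theorem pathCoeff_const_I (γ : ℂ) {d : ℕ} {U : Fin d → Matrix (ι → Bool) (ι → Bool) ℂ}
    (hU : ∀ t, U t ∈ Matrix.unitaryGroup (ι → Bool) ℂ) (ρ O : Matrix (ι → Bool) (ι → Bool) ℂ) :
    pathCoeff γ U ρ O (fun _ _ => Pauli.I) = ((2 : ℂ) ^ Fintype.card ι)⁻¹ * O.trace * ρ.trace := by
  have hUU : ∀ t, U t * (U t)ᴴ = 1 := fun t => by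
    simpa only [star_eq_conjTranspose] using Matrix.mem_unitaryGroup_iff.mp (hU t)
  have h2 : ((2 : ℂ) ^ Fintype.card ι) ≠ 0 := pow_ne_zero _ two_ne_zero
  have hamp : ∀ t : Fin d, transAmp γ (U t) (fun _ => Pauli.I) (fun _ => Pauli.I) =
      (2 : ℂ) ^ Fintype.card ι := by
    intro t
    rw [transAmp, depolarizeAll_pauliString, strWeight_const_I, pow_zero, one_smul,
      pauliString_const_I, Matrix.one_mul, Matrix.mul_one, hUU, trace_one_reg]
  have hE1 : depolarizeAll γ (1 : Matrix (ι → Bool) (ι → Bool) ℂ) = 1 := by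
    have h := depolarizeAll_pauliString γ (fun _ : ι => Pauli.I)
    rwa [strWeight_const_I, pow_zero, one_smul, pauliString_const_I] at h
  simp only [pathCoeff, hamp, Finset.prod_const, Finset.card_univ, Fintype.card_fin,
    pauliString_const_I, hE1, Matrix.mul_one, Matrix.one_mul]
  rw [pow_succ, inv_pow]
  field_simp

/-! ### Lemma 4's chain: the frame-averaged collision sum is the total Fourier weight -/

/-- The squared path contribution read out at a basis projector does not depend on the basis state, at
every noise rate (the `γ = 0` case is `pathCoeff_zero_proj_sq`): `f̃(C,s,x)² = f̃(C,s,y)²`.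
[cite: AharonovEtAl2023, §2 (display f(C,s,x)² = f(C,s,0ⁿ)² after Definition 2)] -/
theorem pathCoeff_proj_sq (γ : ℂ) {d : ℕ} (U : Fin d → Matrix (ι → Bool) (ι → Bool) ℂ)
    (ρ : Matrix (ι → Bool) (ι → Bool) ℂ) (x y : ι → Bool) (s : Fin (d + 1) → ι → Pauli) :
    pathCoeff γ U ρ (proj x) s ^ 2 = pathCoeff γ U ρ (proj y) s ^ 2 := by
  rw [pathCoeff_sq_eq_pow_mul γ U ρ (proj x) s, pathCoeff_sq_eq_pow_mul γ U ρ (proj y) s,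
    pathCoeff_zero_proj_sq U ρ x y s]

/-- The Fourier weight at degree `k` of the Pauli-frame ensemble of a fixed layer sequence,
`W_k = 2^{2n} E_W Σ_{|s| = k} f(C_W,s,x₀)² = 2^{2n} Σ_{|s| = k} f(C,s,x₀)²` (the frames do not change
`f²`, `sum_frame_pathCoeff_sq`), written with the noise rate as a parameter (`γ = 0` is the printed
`W_k`; for `γ > 0` every summand carries `(1−γ)^{2k}`, `pathCoeff_sq_eq_pow_mul`).
[cite: AharonovEtAl2023, Definition 5 (Fourier weight)] -/
def fourierWeight (γ : ℂ) {d : ℕ} (U : Fin d → Matrix (ι → Bool) (ι → Bool) ℂ)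
    (ρ : Matrix (ι → Bool) (ι → Bool) ℂ) (x₀ : ι → Bool) (k : ℕ) : ℂ :=
  ((2 : ℂ) ^ Fintype.card ι) ^ 2 *
    ∑ s ∈ Finset.univ.filter (fun s : Fin (d + 1) → ι → Pauli => pathWeight s = k),
      pathCoeff γ U ρ (proj x₀) s ^ 2

omit [DecidableEq ι] in
/-- A string's Hamming weight is at most the number of wires. [cite: AharonovEtAl2023, §2 (Hamming weight)] -/
theorem strWeight_le_card (S : ι → Pauli) : strWeight S ≤ Fintype.card ι := by
  rw [strWeight_eq]
  exact (Finset.card_filter_le _ _).trans (Finset.card_univ (α := ι)).le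

omit [DecidableEq ι] in
/-- A path's Hamming weight is at most `n(d+1)` ("there are `n(d+1)` locations in the circuit to insert
Pauli paths"). [cite: AharonovEtAl2023, §3.2 (first paragraph)] -/
theorem pathWeight_le {d : ℕ} (s : Fin (d + 1) → ι → Pauli) :
    pathWeight s ≤ Fintype.card ι * (d + 1) := by
  rw [pathWeight_eq]
  calc ∑ t, strWeight (s t) ≤ ∑ _t : Fin (d + 1), Fintype.card ι :=
        Finset.sum_le_sum fun t _ => strWeight_le_card (s t)
    _ = Fintype.card ι * (d + 1) := by
        rw [Finset.sum_const, Finset.card_univ, Fintype.card_fin, smul_eq_mul, mul_comm]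

/-- Regrouping by degree: `2^{2n} Σ_s f̃(C,s,x₀)² = Σ_{k=0}^{n(d+1)} W_k` ("the fifth line": the sum over
all paths split by Hamming weight). [cite: AharonovEtAl2023, §2 (proof of Lemma 4, last two lines of the chain)] -/
theorem sum_range_fourierWeight (γ : ℂ) {d : ℕ} (U : Fin d → Matrix (ι → Bool) (ι → Bool) ℂ)
    (ρ : Matrix (ι → Bool) (ι → Bool) ℂ) (x₀ : ι → Bool) :
    ∑ k ∈ Finset.range (Fintype.card ι * (d + 1) + 1), fourierWeight γ U ρ x₀ k =
      ((2 : ℂ) ^ Fintype.card ι) ^ 2 * ∑ s : Fin (d + 1) → ι → Pauli, pathCoeff γ U ρ (proj x₀) s ^ 2 := by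
  simp only [fourierWeight, ← Finset.mul_sum]
  congr 1
  exact Finset.sum_fiberwise_of_maps_to (fun s _ => Finset.mem_range.2
    (Nat.lt_succ_of_le (pathWeight_le s))) _

/-- **Lemma 4's chain for the Pauli-frame ensemble** ("the second line follows from the Pauli path
integral; the fourth line follows from orthogonality (Lemma 3)"; the fifth line follows from
Eq. (eq:boundarysign), which is the display `f(C,s,x)² = f(C,s,0ⁿ)²` of §2, arXiv p. 7 L62): the
frame-summed collision quantity equals the frame count times the total Fourier weight,
`2ⁿ Σ_W Σ_x p̃_W(x)² = (4ⁿ)^{d+1} · 2^{2n} Σ_s f̃(C,s,x₀)² = (4ⁿ)^{d+1} Σ_k W_k`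
(read-out `|x⟩⟨x|`, any input `ρ`, any layer matrices, any noise rate; divide by `(4ⁿ)^{d+1}` for the
expectation over a uniformly random frame). [cite: AharonovEtAl2023, Lemma 4 (proof: the chain from anti-concentration to Σ_k W_k)] -/
theorem sum_frame_sum_sq_noisyValue_proj (γ : ℂ) {d : ℕ} (U : Fin d → Matrix (ι → Bool) (ι → Bool) ℂ)
    (ρ : Matrix (ι → Bool) (ι → Bool) ℂ) (x₀ : ι → Bool) :
    (2 : ℂ) ^ Fintype.card ι * ∑ W : Fin (d + 1) → ι → Pauli, ∑ x : ι → Bool,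
        noisyValue γ (frameLayers U W) ρ (frameObs (proj x) W) ^ 2 =
      (((4 : ℂ) ^ Fintype.card ι) ^ (d + 1)) *
        ∑ k ∈ Finset.range (Fintype.card ι * (d + 1) + 1), fourierWeight γ U ρ x₀ k := by
  rw [sum_range_fourierWeight, Finset.sum_comm]
  -- for each `x`: path integral, then orthogonality over the frames
  have hx : ∀ x : ι → Bool, ∑ W : Fin (d + 1) → ι → Pauli,
      noisyValue γ (frameLayers U W) ρ (frameObs (proj x) W) ^ 2 =
      (((4 : ℂ) ^ Fintype.card ι) ^ (d + 1)) * ∑ s : Fin (d + 1) → ι → Pauli,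
        pathCoeff γ U ρ (proj x₀) s ^ 2 := by
    intro x
    have h := sum_frame_sq_sum_pathCoeff γ U ρ (proj x) Finset.univ
    simp only [← noisyValue_eq_sum_pathCoeff] at h
    rw [h, Finset.sum_congr rfl fun s _ => pathCoeff_proj_sq γ U ρ x x₀ s]
  rw [Finset.sum_congr rfl fun x _ => hx x, Finset.sum_const, Finset.card_univ, nsmul_eq_mul,
    Fintype.card_fun, Fintype.card_bool]
  push_cast
  ring

/-! ### The `ℓ`-truncation error in real form: §3.1's chain with eq. (sumoflow), frame ensemble

For a real noise rate `0 ≤ γ ≤ 1`, Hermitian input `ρ` and the read-out projectors `|x⟩⟨x|`, all path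
coefficients are real, and the complex identities above become the printed real (in)equalities:
`E_W Σ_x (p̃_W(x) − q̄_W(x))² = Σ_x Σ_{|s|>ℓ} (1−γ)^{2|s|} f(C,s,x)² ≤ (1−γ)^{2(ℓ+1)} Σ_x Σ_s f(C,s,x)²
= (1−γ)^{2(ℓ+1)} E_W Σ_x p_W(x)²` — lines 2–5 of the `E[Δ²]` chain followed by the first inequality of
eq. (sumoflow) and Lemma 4's chain read backwards. What is NOT here: the anti-concentration input
`2ⁿ E Σ_x p² = O(1)` (an assumption on the ensemble) and the first line (Cauchy–Schwarz,
`sq_sum_abs_le_card_mul_sum_sq`). -/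

omit [DecidableEq ι] in
/-- `|x⟩⟨x|` is Hermitian (the read-out operators of Table 1 (c)). [cite: AharonovEtAl2023, §2 (Table 1, |x⟩⟨x|)] -/
theorem conjTranspose_proj (x : ι → Bool) : (proj x)ᴴ = proj x := by
  ext a b
  simp only [Matrix.conjTranspose_apply, proj_apply]
  by_cases ha : a = x <;> by_cases hb : b = x <;> simp [ha, hb]

omit [Fintype ι] [DecidableEq ι] in
/-- The conjugation signs are real. [folklore] -/
private theorem conj_sign (Q P : Pauli) : (starRingEnd ℂ) (Pauli.sign Q P) = Pauli.sign Q P := by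
  unfold Pauli.sign
  split_ifs <;> simp

omit [DecidableEq ι] in
/-- The sign characters are real. [folklore] -/
private theorem conj_strSign (W S : ι → Pauli) : (starRingEnd ℂ) (strSign W S) = strSign W S := by
  rw [strSign_eq, map_prod]
  exact Finset.prod_congr rfl fun i _ => conj_sign _ _

/-- **`f̃(C,s,x) ∈ ℝ`** at a real noise rate, for Hermitian read-out and input.
[cite: AharonovEtAl2023, §2 (f(C,s,x) ∈ ℝ, display after Definition 2)] -/
theorem conj_pathCoeff_ofReal (r : ℝ) {d : ℕ} (U : Fin d → Matrix (ι → Bool) (ι → Bool) ℂ)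
    {ρ O : Matrix (ι → Bool) (ι → Bool) ℂ} (hρ : ρᴴ = ρ) (hO : Oᴴ = O) (s : Fin (d + 1) → ι → Pauli) :
    (starRingEnd ℂ) (pathCoeff (r : ℂ) U ρ O s) = pathCoeff (r : ℂ) U ρ O s := by
  rw [pathCoeff_eq_pow_mul_pathCoeff_zero, map_mul, map_pow, map_sub, map_one, Complex.conj_ofReal,
    conj_pathCoeff_zero U hρ hO]

omit [Fintype ι] [DecidableEq ι] in
/-- The square of a real complex number is the cast of its squared modulus. [folklore] -/
private theorem sq_eq_ofReal_norm_sq {z : ℂ} (hz : (starRingEnd ℂ) z = z) :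
    z ^ 2 = ((‖z‖ ^ 2 : ℝ) : ℂ) := by
  obtain ⟨t, rfl⟩ : ∃ t : ℝ, (t : ℂ) = z := ⟨z.re, Complex.conj_eq_iff_re.mp hz⟩
  rw [Complex.norm_real, Real.norm_eq_abs, sq_abs]
  push_cast
  ring

/-- The framed truncation error `p̃_W − q̄_W` is real (real rate, Hermitian `ρ`, `O`). [cite: AharonovEtAl2023, §3.1 (E[Δ²] chain)] -/
private theorem conj_noisyValue_sub_truncValue_frame (r : ℝ) (ℓ : ℕ) {d : ℕ}
    (U : Fin d → Matrix (ι → Bool) (ι → Bool) ℂ) {ρ O : Matrix (ι → Bool) (ι → Bool) ℂ}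
    (hρ : ρᴴ = ρ) (hO : Oᴴ = O) (W : Fin (d + 1) → ι → Pauli) :
    (starRingEnd ℂ) (noisyValue (r : ℂ) (frameLayers U W) ρ (frameObs O W) -
        truncValue (r : ℂ) ℓ (frameLayers U W) ρ (frameObs O W)) =
      noisyValue (r : ℂ) (frameLayers U W) ρ (frameObs O W) -
        truncValue (r : ℂ) ℓ (frameLayers U W) ρ (frameObs O W) := by
  rw [noisyValue_sub_truncValue, map_sum]
  refine Finset.sum_congr rfl fun s _ => ?_
  rw [pathCoeff_frame, map_mul, map_prod, conj_pathCoeff_ofReal r U hρ hO]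
  congr 1
  exact Finset.prod_congr rfl fun t _ => conj_strSign _ _

/-- The framed noisy value `p̃_W` is real (real rate, Hermitian `ρ`, `O`). [cite: AharonovEtAl2023, Definition 1 (p̃(C,x))] -/
private theorem conj_noisyValue_frame (r : ℝ) {d : ℕ}
    (U : Fin d → Matrix (ι → Bool) (ι → Bool) ℂ) {ρ O : Matrix (ι → Bool) (ι → Bool) ℂ}
    (hρ : ρᴴ = ρ) (hO : Oᴴ = O) (W : Fin (d + 1) → ι → Pauli) :
    (starRingEnd ℂ) (noisyValue (r : ℂ) (frameLayers U W) ρ (frameObs O W)) =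
      noisyValue (r : ℂ) (frameLayers U W) ρ (frameObs O W) := by
  rw [noisyValue_eq_sum_pathCoeff, map_sum]
  refine Finset.sum_congr rfl fun s _ => ?_
  rw [pathCoeff_frame, map_mul, map_prod, conj_pathCoeff_ofReal r U hρ hO]
  congr 1
  exact Finset.prod_congr rfl fun t _ => conj_strSign _ _

/-- **Third line of the `E[Δ²]` chain, real form**: for a real rate and Hermitian `ρ`, `O`,
`Σ_W (p̃_W − q̄_W)² = (4ⁿ)^{d+1} Σ_{|s|>ℓ} (1−γ)^{2|s|} f(C,s)²` with genuine real squares.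
[cite: AharonovEtAl2023, §3.1 (E[Δ²] chain, lines 2–4)] -/
theorem sum_frame_norm_sq_noisyValue_sub_truncValue (r : ℝ) (ℓ : ℕ) {d : ℕ}
    (U : Fin d → Matrix (ι → Bool) (ι → Bool) ℂ) {ρ O : Matrix (ι → Bool) (ι → Bool) ℂ}
    (hρ : ρᴴ = ρ) (hO : Oᴴ = O) :
    ∑ W : Fin (d + 1) → ι → Pauli, ‖noisyValue (r : ℂ) (frameLayers U W) ρ (frameObs O W) -
        truncValue (r : ℂ) ℓ (frameLayers U W) ρ (frameObs O W)‖ ^ 2 =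
      ((4 : ℝ) ^ Fintype.card ι) ^ (d + 1) *
        ∑ s ∈ Finset.univ.filter (fun s : Fin (d + 1) → ι → Pauli => ¬ pathWeight s ≤ ℓ),
          ((1 - r) ^ 2) ^ pathWeight s * ‖pathCoeff 0 U ρ O s‖ ^ 2 := by
  have h := sum_frame_sq_noisyValue_sub_truncValue (r : ℂ) ℓ U ρ O
  rw [Finset.sum_congr rfl fun W _ =>
      sq_eq_ofReal_norm_sq (conj_noisyValue_sub_truncValue_frame r ℓ U hρ hO W),
    Finset.sum_congr rfl fun s _ => (by
      rw [pathCoeff_sq_eq_pow_mul, sq_eq_ofReal_norm_sq (conj_pathCoeff_zero U hρ hO s)] :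
      pathCoeff (r : ℂ) U ρ O s ^ 2 = ((1 - (r : ℂ)) ^ 2) ^ pathWeight s * ((‖pathCoeff 0 U ρ O s‖ ^ 2 : ℝ) : ℂ))] at h
  exact_mod_cast h

/-- **Second line of Lemma 4's chain, real form**: `Σ_W p̃_W² = (4ⁿ)^{d+1} Σ_s (1−γ)^{2|s|} f(C,s)²`
(at `γ = 0`: `E_W p_W² = Σ_s f(C,s)²`, "the second line follows from the Pauli path integral … the
fourth line follows from orthogonality"). [cite: AharonovEtAl2023, Lemma 4 (proof, lines 2–4 of the chain)] -/
theorem sum_frame_norm_sq_noisyValue (r : ℝ) {d : ℕ}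
    (U : Fin d → Matrix (ι → Bool) (ι → Bool) ℂ) {ρ O : Matrix (ι → Bool) (ι → Bool) ℂ}
    (hρ : ρᴴ = ρ) (hO : Oᴴ = O) :
    ∑ W : Fin (d + 1) → ι → Pauli, ‖noisyValue (r : ℂ) (frameLayers U W) ρ (frameObs O W)‖ ^ 2 =
      ((4 : ℝ) ^ Fintype.card ι) ^ (d + 1) *
        ∑ s : Fin (d + 1) → ι → Pauli, ((1 - r) ^ 2) ^ pathWeight s * ‖pathCoeff 0 U ρ O s‖ ^ 2 := by
  have h := sum_frame_sq_sum_pathCoeff (r : ℂ) U ρ O Finset.univ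
  simp only [← noisyValue_eq_sum_pathCoeff] at h
  rw [Finset.sum_congr rfl fun W _ => sq_eq_ofReal_norm_sq (conj_noisyValue_frame r U hρ hO W),
    Finset.sum_congr rfl fun s _ => (by
      rw [pathCoeff_sq_eq_pow_mul, sq_eq_ofReal_norm_sq (conj_pathCoeff_zero U hρ hO s)] :
      pathCoeff (r : ℂ) U ρ O s ^ 2 = ((1 - (r : ℂ)) ^ 2) ^ pathWeight s * ((‖pathCoeff 0 U ρ O s‖ ^ 2 : ℝ) : ℂ))] at h
  exact_mod_cast h

/-- **The `ℓ`-truncation error bound for the Pauli-frame ensemble** (§3.1's `E[Δ²]` chain lines 2–5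
with the first inequality of eq. (sumoflow), `Σ_{k>ℓ} (1−γ)^{2k} W_k ≤ (1−γ)^{2ℓ} Σ_{k>ℓ} W_k`, and
Lemma 4's chain read backwards): for a real rate `0 ≤ γ ≤ 1`, Hermitian input `ρ`, any layer matrices
and every truncation degree `ℓ`,
`Σ_W Σ_x (p̃_W(x) − q̄_W(x))² ≤ (1−γ)^{2(ℓ+1)} · Σ_W Σ_x p_W(x)²`,
where `p_W` is the noiseless output value of the framed circuit. Feeding the anti-concentration
assumption `2ⁿ E_W Σ_x p_W(x)² = O(1)` and Cauchy–Schwarz (`sq_sum_abs_le_card_mul_sum_sq`) into this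
inequality is exactly the printed `E[Δ²] ≤ O(1)·(1−γ)^{2ℓ}`; neither is asserted here.
[cite: AharonovEtAl2023, §3.1 (E[Δ²] chain and eq. (sumoflow))] -/
theorem sum_frame_sum_norm_sq_sub_truncValue_le (r : ℝ) (hr0 : 0 ≤ r) (hr1 : r ≤ 1) (ℓ : ℕ) {d : ℕ}
    (U : Fin d → Matrix (ι → Bool) (ι → Bool) ℂ) {ρ : Matrix (ι → Bool) (ι → Bool) ℂ} (hρ : ρᴴ = ρ) :
    ∑ W : Fin (d + 1) → ι → Pauli, ∑ x : ι → Bool,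
        ‖noisyValue (r : ℂ) (frameLayers U W) ρ (frameObs (proj x) W) -
          truncValue (r : ℂ) ℓ (frameLayers U W) ρ (frameObs (proj x) W)‖ ^ 2 ≤
      ((1 - r) ^ 2) ^ (ℓ + 1) * ∑ W : Fin (d + 1) → ι → Pauli, ∑ x : ι → Bool,
        ‖noisyValue 0 (frameLayers U W) ρ (frameObs (proj x) W)‖ ^ 2 := by
  rw [Finset.sum_comm, Finset.sum_comm (f := fun W x => ‖noisyValue 0 _ _ _‖ ^ 2), Finset.mul_sum]
  refine Finset.sum_le_sum fun x _ => ?_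
  set c : ℝ := ((4 : ℝ) ^ Fintype.card ι) ^ (d + 1) with hc
  have hc0 : 0 ≤ c := by positivity
  have h0 := sum_frame_norm_sq_noisyValue 0 U hρ (conjTranspose_proj x)
  simp only [Complex.ofReal_zero, sub_zero, one_pow, one_mul] at h0
  rw [sum_frame_norm_sq_noisyValue_sub_truncValue r ℓ U hρ (conjTranspose_proj x), h0, ← hc,
    mul_left_comm]
  refine mul_le_mul_of_nonneg_left ?_ hc0
  calc ∑ s ∈ Finset.univ.filter (fun s : Fin (d + 1) → ι → Pauli => ¬ pathWeight s ≤ ℓ),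
        ((1 - r) ^ 2) ^ pathWeight s * ‖pathCoeff 0 U ρ (proj x) s‖ ^ 2
      ≤ ((1 - r) ^ 2) ^ (ℓ + 1) *
          ∑ s ∈ Finset.univ.filter (fun s : Fin (d + 1) → ι → Pauli => ¬ pathWeight s ≤ ℓ),
            ‖pathCoeff 0 U ρ (proj x) s‖ ^ 2 :=
        sum_pow_mul_le_pow_mul_sum _ pathWeight _ (fun s _ => by positivity) hr0 hr1 ℓ
          (fun s hs => Nat.lt_of_not_le (Finset.mem_filter.1 hs).2)
    _ ≤ ((1 - r) ^ 2) ^ (ℓ + 1) * ∑ s : Fin (d + 1) → ι → Pauli, ‖pathCoeff 0 U ρ (proj x) s‖ ^ 2 :=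
        mul_le_mul_of_nonneg_left
          (Finset.sum_le_univ_sum_of_nonneg fun s => by positivity) (by positivity)

/-- **`E[Δ²]` up to anti-concentration** (the whole §3.1 chain with its first line, Cauchy–Schwarz,
and eq. (sumoflow)): with the `L¹` error `Δ_W := Σ_x |p̃_W(x) − q̄_W(x)|` of the truncated estimate,
`Σ_W Δ_W² ≤ 2ⁿ (1−γ)^{2(ℓ+1)} Σ_W Σ_x p_W(x)²`; dividing by the frame count and inserting the
anti-concentration ASSUMPTION `2ⁿ E_W Σ_x p_W(x)² = O(1)` (not asserted here) gives the printed
`E[Δ²] ≤ O(1)·(1−γ)^{2ℓ}`, hence total-variation error `O(1)·(1−γ)^{ℓ}` by Jensen/Markov.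
[cite: AharonovEtAl2023, §3.1 (E[Δ²] chain, all five lines, and eq. (sumoflow))] -/
theorem sum_frame_sq_l1_truncError_le (r : ℝ) (hr0 : 0 ≤ r) (hr1 : r ≤ 1) (ℓ : ℕ) {d : ℕ}
    (U : Fin d → Matrix (ι → Bool) (ι → Bool) ℂ) {ρ : Matrix (ι → Bool) (ι → Bool) ℂ} (hρ : ρᴴ = ρ) :
    ∑ W : Fin (d + 1) → ι → Pauli, (∑ x : ι → Bool,
        ‖noisyValue (r : ℂ) (frameLayers U W) ρ (frameObs (proj x) W) -
          truncValue (r : ℂ) ℓ (frameLayers U W) ρ (frameObs (proj x) W)‖) ^ 2 ≤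
      (2 : ℝ) ^ Fintype.card ι * (((1 - r) ^ 2) ^ (ℓ + 1) *
        ∑ W : Fin (d + 1) → ι → Pauli, ∑ x : ι → Bool,
          ‖noisyValue 0 (frameLayers U W) ρ (frameObs (proj x) W)‖ ^ 2) := by
  have hcs : ∀ W : Fin (d + 1) → ι → Pauli, (∑ x : ι → Bool,
      ‖noisyValue (r : ℂ) (frameLayers U W) ρ (frameObs (proj x) W) -
        truncValue (r : ℂ) ℓ (frameLayers U W) ρ (frameObs (proj x) W)‖) ^ 2 ≤
      (2 : ℝ) ^ Fintype.card ι * ∑ x : ι → Bool,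
        ‖noisyValue (r : ℂ) (frameLayers U W) ρ (frameObs (proj x) W) -
          truncValue (r : ℂ) ℓ (frameLayers U W) ρ (frameObs (proj x) W)‖ ^ 2 := by
    intro W
    have h := sq_sum_abs_le_card_mul_sum_sq (fun x : ι → Bool =>
      ‖noisyValue (r : ℂ) (frameLayers U W) ρ (frameObs (proj x) W) -
        truncValue (r : ℂ) ℓ (frameLayers U W) ρ (frameObs (proj x) W)‖)
    simp only [abs_norm, Fintype.card_fun, Fintype.card_bool] at h
    push_cast at h
    exact h
  calc ∑ W : Fin (d + 1) → ι → Pauli, (∑ x : ι → Bool,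
        ‖noisyValue (r : ℂ) (frameLayers U W) ρ (frameObs (proj x) W) -
          truncValue (r : ℂ) ℓ (frameLayers U W) ρ (frameObs (proj x) W)‖) ^ 2
      ≤ ∑ W : Fin (d + 1) → ι → Pauli, (2 : ℝ) ^ Fintype.card ι * ∑ x : ι → Bool,
          ‖noisyValue (r : ℂ) (frameLayers U W) ρ (frameObs (proj x) W) -
            truncValue (r : ℂ) ℓ (frameLayers U W) ρ (frameObs (proj x) W)‖ ^ 2 :=
        Finset.sum_le_sum fun W _ => hcs W
    _ ≤ (2 : ℝ) ^ Fintype.card ι * (((1 - r) ^ 2) ^ (ℓ + 1) *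
          ∑ W : Fin (d + 1) → ι → Pauli, ∑ x : ι → Bool,
            ‖noisyValue 0 (frameLayers U W) ρ (frameObs (proj x) W)‖ ^ 2) := by
        rw [← Finset.mul_sum]
        exact mul_le_mul_of_nonneg_left (sum_frame_sum_norm_sq_sub_truncValue_le r hr0 hr1 ℓ U hρ)
          (by positivity)

/-! ### "The fifth line is by definition of Fourier weight" and the exponential form of the bound -/

/-- **Fifth line of the `E[Δ²]` chain, frame ensemble**: the frame-summed squared truncation error is a
damped sum of Fourier weights,
`2ⁿ · Σ_W Σ_x (p̃_W(x) − q̄_W(x))² = (4ⁿ)^{d+1} · Σ_{k>ℓ} (1−γ)^{2k} W_k`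
(`W_k` the noiseless Fourier weight `fourierWeight 0`, lines 2–5 of the chain: definition of `q̄`,
orthogonality, `f(C,s,x)² = f(C,s,0ⁿ)²`, regrouping by degree).
[cite: AharonovEtAl2023, §3.1 (E[Δ²] chain, lines 2–5: "= Σ_{k>ℓ} (1−γ)^{2k} W_k")] -/
theorem sum_frame_sum_sq_sub_truncValue_eq_sum_fourierWeight (γ : ℂ) (ℓ : ℕ) {d : ℕ}
    (U : Fin d → Matrix (ι → Bool) (ι → Bool) ℂ) (ρ : Matrix (ι → Bool) (ι → Bool) ℂ) (x₀ : ι → Bool) :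
    (2 : ℂ) ^ Fintype.card ι * ∑ W : Fin (d + 1) → ι → Pauli, ∑ x : ι → Bool,
        (noisyValue γ (frameLayers U W) ρ (frameObs (proj x) W) -
          truncValue γ ℓ (frameLayers U W) ρ (frameObs (proj x) W)) ^ 2 =
      (((4 : ℂ) ^ Fintype.card ι) ^ (d + 1)) *
        ∑ k ∈ (Finset.range (Fintype.card ι * (d + 1) + 1)).filter (fun k => ℓ < k),
          ((1 - γ) ^ 2) ^ k * fourierWeight 0 U ρ x₀ k := by
  rw [Finset.sum_comm]
  -- per `x`: orthogonality over the frames, damping, independence of `x`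
  have hx : ∀ x : ι → Bool, ∑ W : Fin (d + 1) → ι → Pauli,
      (noisyValue γ (frameLayers U W) ρ (frameObs (proj x) W) -
        truncValue γ ℓ (frameLayers U W) ρ (frameObs (proj x) W)) ^ 2 =
      (((4 : ℂ) ^ Fintype.card ι) ^ (d + 1)) *
        ∑ s ∈ Finset.univ.filter (fun s : Fin (d + 1) → ι → Pauli => ¬ pathWeight s ≤ ℓ),
          ((1 - γ) ^ 2) ^ pathWeight s * pathCoeff 0 U ρ (proj x₀) s ^ 2 := by
    intro x
    rw [sum_frame_sq_noisyValue_sub_truncValue]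
    congr 1
    exact Finset.sum_congr rfl fun s _ => by
      rw [pathCoeff_sq_eq_pow_mul, pathCoeff_zero_proj_sq U ρ x x₀ s]
  rw [Finset.sum_congr rfl fun x _ => hx x, Finset.sum_const, Finset.card_univ, nsmul_eq_mul,
    Fintype.card_fun, Fintype.card_bool]
  -- regroup the high-weight paths by degree
  have hfib : ∑ s ∈ Finset.univ.filter (fun s : Fin (d + 1) → ι → Pauli => ¬ pathWeight s ≤ ℓ),
      ((1 - γ) ^ 2) ^ pathWeight s * pathCoeff 0 U ρ (proj x₀) s ^ 2 =
      ∑ k ∈ (Finset.range (Fintype.card ι * (d + 1) + 1)).filter (fun k => ℓ < k),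
        ((1 - γ) ^ 2) ^ k * ∑ s ∈ Finset.univ.filter (fun s : Fin (d + 1) → ι → Pauli => pathWeight s = k),
          pathCoeff 0 U ρ (proj x₀) s ^ 2 := by
    rw [← Finset.sum_fiberwise_of_maps_to (g := pathWeight)
      (t := (Finset.range (Fintype.card ι * (d + 1) + 1)).filter (fun k => ℓ < k))
      (fun s hs => Finset.mem_filter.2 ⟨Finset.mem_range.2 (Nat.lt_succ_of_le (pathWeight_le s)),
        Nat.lt_of_not_le (Finset.mem_filter.1 hs).2⟩)]
    refine Finset.sum_congr rfl fun k hk => ?_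
    rw [Finset.mul_sum, Finset.filter_filter]
    have hset : (Finset.univ.filter fun s : Fin (d + 1) → ι → Pauli => ¬ pathWeight s ≤ ℓ ∧ pathWeight s = k) =
        Finset.univ.filter fun s : Fin (d + 1) → ι → Pauli => pathWeight s = k := by
      ext s
      simp only [Finset.mem_filter, Finset.mem_univ, true_and]
      exact ⟨fun h => h.2, fun h => ⟨by rw [h]; exact Nat.not_le_of_lt (Finset.mem_filter.1 hk).2, h⟩⟩
    rw [hset]
    exact Finset.sum_congr rfl fun s hs => by rw [(Finset.mem_filter.1 hs).2]
  rw [hfib]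
  simp only [fourierWeight, Finset.mul_sum]
  push_cast
  refine Finset.sum_congr rfl fun k _ => Finset.sum_congr rfl fun s _ => ?_
  ring

omit [Fintype ι] [DecidableEq ι] in
/-- **`(1−γ)^{2ℓ} ≤ e^{−2γℓ}`** — the exponential form of the damping factor used in the "simple upper
bound" `E[Δ²] ≤ … ≤ O(1)·e^{−2γℓ}`. [cite: AharonovEtAl2023, §3.1 (eq. (sumoflow), last inequality)] -/
theorem one_sub_sq_pow_le_exp {γ : ℝ} (hγ1 : γ ≤ 1) (ℓ : ℕ) :
    ((1 - γ) ^ 2) ^ ℓ ≤ Real.exp (-(2 * γ * ℓ)) := by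
  have h1 : (1 - γ) ^ 2 ≤ Real.exp (-(2 * γ)) := by
    have h := Real.one_sub_le_exp_neg γ
    calc (1 - γ) ^ 2 ≤ Real.exp (-γ) ^ 2 := pow_le_pow_left₀ (by linarith) h 2
      _ = Real.exp (-(2 * γ)) := by rw [← Real.exp_nat_mul]; ring_nf
  calc ((1 - γ) ^ 2) ^ ℓ ≤ Real.exp (-(2 * γ)) ^ ℓ := pow_le_pow_left₀ (by positivity) h1 ℓ
    _ = Real.exp (-(2 * γ * ℓ)) := by rw [← Real.exp_nat_mul]; ring_nf

/-! ### The `L₁` error `Δ` itself: "Δ ≤ ε with high probability" (Jensen and Markov over the frames)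

[cite: AharonovEtAl2023, §3 (display defining Δ) and §3.1 (last paragraph)]: "Our goal is to compute a
function `q̄(C,x)` that achieves small `L_1` distance `Δ := ‖p̃ − q̄‖₁ := Σ_{x∈{0,1}ⁿ} |p̃(C,x) − q̄(C,x)|`
with high probability" … "By choosing `ℓ = O(1/ε)` (roughly `ℓ ≈ (1/γ)·log(1/ε)`) we can guarantee that
`Δ ≤ ε` with high probability." The two elementary steps from `E[Δ²]` to that sentence — Jensen
(`E[Δ] ≤ √E[Δ²]`) and Markov (`Pr[Δ ≥ ε] ≤ E[Δ²]/ε²`) — are recorded here for the Pauli-frame ensemble,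
with the anti-concentration input kept EXPLICIT as the factor `2ⁿ · E_W Σ_x p_W(x)²` (never asserted). -/

/-- The `L₁` truncation error of the framed circuit `C_W` at noise rate `r` and cut-off `ℓ`:
`Δ_W := Σ_x |p̃_W(x) − q̄_W(x)|`. [cite: AharonovEtAl2023, §3 (display defining Δ := ‖p̃ − q̄‖₁)] -/
def l1TruncError (r : ℝ) (ℓ : ℕ) {d : ℕ} (U : Fin d → Matrix (ι → Bool) (ι → Bool) ℂ)
    (ρ : Matrix (ι → Bool) (ι → Bool) ℂ) (W : Fin (d + 1) → ι → Pauli) : ℝ :=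
  ∑ x : ι → Bool, ‖noisyValue (r : ℂ) (frameLayers U W) ρ (frameObs (proj x) W) -
    truncValue (r : ℂ) ℓ (frameLayers U W) ρ (frameObs (proj x) W)‖

/-- `0 ≤ Δ_W`. [cite: AharonovEtAl2023, §3 (Δ is an L₁ norm)] -/
theorem l1TruncError_nonneg (r : ℝ) (ℓ : ℕ) {d : ℕ} (U : Fin d → Matrix (ι → Bool) (ι → Bool) ℂ)
    (ρ : Matrix (ι → Bool) (ι → Bool) ℂ) (W : Fin (d + 1) → ι → Pauli) : 0 ≤ l1TruncError r ℓ U ρ W :=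
  Finset.sum_nonneg fun _ _ => norm_nonneg _

/-- The capstone `sum_frame_sq_l1_truncError_le` in `Δ`-notation:
`Σ_W Δ_W² ≤ 2ⁿ (1−γ)^{2(ℓ+1)} Σ_W Σ_x p_W(x)²`. [cite: AharonovEtAl2023, §3.1 (E[Δ²] chain and eq. (sumoflow))] -/
theorem sum_frame_l1TruncError_sq_le (r : ℝ) (hr0 : 0 ≤ r) (hr1 : r ≤ 1) (ℓ : ℕ) {d : ℕ}
    (U : Fin d → Matrix (ι → Bool) (ι → Bool) ℂ) {ρ : Matrix (ι → Bool) (ι → Bool) ℂ} (hρ : ρᴴ = ρ) :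
    ∑ W : Fin (d + 1) → ι → Pauli, l1TruncError r ℓ U ρ W ^ 2 ≤
      (2 : ℝ) ^ Fintype.card ι * (((1 - r) ^ 2) ^ (ℓ + 1) *
        ∑ W : Fin (d + 1) → ι → Pauli, ∑ x : ι → Bool,
          ‖noisyValue 0 (frameLayers U W) ρ (frameObs (proj x) W)‖ ^ 2) :=
  sum_frame_sq_l1_truncError_le r hr0 hr1 ℓ U hρ

/-- **Jensen step, frame ensemble**: the frame-AVERAGED `L₁` error obeys
`E_W[Δ_W] ≤ (1−γ)^{ℓ+1} · √(2ⁿ · E_W Σ_x p_W(x)²)`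
(from `E[Δ] ≤ √E[Δ²]` and the `E[Δ²]` chain); with the anti-concentration ASSUMPTION
`2ⁿ E Σ_x p² = O(1)` (not asserted here) this is the printed "total variation distance … `2^{−Ω(ℓ)}` on
average" / `E[Δ] ≤ O(1)·(1−γ)^ℓ`. Expectations are written as frame sums divided by the frame count
`F = (4^{|ι|})^{d+1}`. [cite: AharonovEtAl2023, §1.1 ("the total variation distance achieved by the approximation is 2^{-Ω(ℓ)} on average") and §3.1] -/
theorem avg_frame_l1TruncError_le (r : ℝ) (hr0 : 0 ≤ r) (hr1 : r ≤ 1) (ℓ : ℕ) {d : ℕ}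
    (U : Fin d → Matrix (ι → Bool) (ι → Bool) ℂ) {ρ : Matrix (ι → Bool) (ι → Bool) ℂ} (hρ : ρᴴ = ρ) :
    (∑ W : Fin (d + 1) → ι → Pauli, l1TruncError r ℓ U ρ W) / ((4 : ℝ) ^ Fintype.card ι) ^ (d + 1) ≤
      (1 - r) ^ (ℓ + 1) * Real.sqrt ((2 : ℝ) ^ Fintype.card ι *
        (∑ W : Fin (d + 1) → ι → Pauli, ∑ x : ι → Bool,
          ‖noisyValue 0 (frameLayers U W) ρ (frameObs (proj x) W)‖ ^ 2) /
            ((4 : ℝ) ^ Fintype.card ι) ^ (d + 1)) := by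
  set F : ℝ := ((4 : ℝ) ^ Fintype.card ι) ^ (d + 1) with hF
  set A : ℝ := ∑ W : Fin (d + 1) → ι → Pauli, l1TruncError r ℓ U ρ W with hA
  set S : ℝ := ∑ W : Fin (d + 1) → ι → Pauli, ∑ x : ι → Bool,
    ‖noisyValue 0 (frameLayers U W) ρ (frameObs (proj x) W)‖ ^ 2 with hS
  have hFpos : 0 < F := by positivity
  have hFcard : (Fintype.card (Fin (d + 1) → ι → Pauli) : ℝ) = F := by
    simp only [Fintype.card_fun, Fintype.card_fin, Pauli.card_univ, hF]
    push_cast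
    ring
  have hA0 : 0 ≤ A := Finset.sum_nonneg fun W _ => l1TruncError_nonneg r ℓ U ρ W
  have hS0 : 0 ≤ S := Finset.sum_nonneg fun W _ => Finset.sum_nonneg fun x _ => by positivity
  have h1r : 0 ≤ 1 - r := by linarith
  -- Cauchy–Schwarz over the frames: `A² ≤ F · Σ_W Δ_W²`, then the `E[Δ²]` chain
  have hcs : A ^ 2 ≤ F * ((2 : ℝ) ^ Fintype.card ι * (((1 - r) ^ 2) ^ (ℓ + 1) * S)) := by
    have h := sq_sum_abs_le_card_mul_sum_sq (fun W : Fin (d + 1) → ι → Pauli => l1TruncError r ℓ U ρ W)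
    rw [hFcard] at h
    have habs : ∑ W : Fin (d + 1) → ι → Pauli, |l1TruncError r ℓ U ρ W| = A :=
      Finset.sum_congr rfl fun W _ => abs_of_nonneg (l1TruncError_nonneg r ℓ U ρ W)
    rw [habs] at h
    exact h.trans (mul_le_mul_of_nonneg_left (sum_frame_l1TruncError_sq_le r hr0 hr1 ℓ U hρ) hFpos.le)
  -- divide by `F²` and take square roots
  have hsq : (A / F) ^ 2 ≤ ((1 - r) ^ 2) ^ (ℓ + 1) * ((2 : ℝ) ^ Fintype.card ι * S / F) := by
    rw [div_pow, div_le_iff₀ (by positivity)]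
    calc A ^ 2 ≤ F * ((2 : ℝ) ^ Fintype.card ι * (((1 - r) ^ 2) ^ (ℓ + 1) * S)) := hcs
      _ = ((1 - r) ^ 2) ^ (ℓ + 1) * ((2 : ℝ) ^ Fintype.card ι * S / F) * F ^ 2 := by
          field_simp
  have hrhs : (1 - r) ^ (ℓ + 1) * Real.sqrt ((2 : ℝ) ^ Fintype.card ι * S / F) =
      Real.sqrt (((1 - r) ^ 2) ^ (ℓ + 1) * ((2 : ℝ) ^ Fintype.card ι * S / F)) := by
    rw [Real.sqrt_mul (by positivity), ← pow_mul, mul_comm 2 (ℓ + 1), pow_mul,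
      Real.sqrt_sq (pow_nonneg h1r _)]
  rw [hrhs]
  exact Real.le_sqrt_of_sq_le hsq

/-- **Markov step, frame ensemble**: for every `ε > 0`, the NUMBER of frames whose `L₁` error is at least
`ε` satisfies `#{W : Δ_W ≥ ε} · ε² ≤ Σ_W Δ_W² ≤ 2ⁿ (1−γ)^{2(ℓ+1)} Σ_W Σ_x p_W(x)²`; dividing by the frame
count, `Pr_W[Δ_W ≥ ε] ≤ (1−γ)^{2(ℓ+1)} · 2ⁿ E_W[Σ_x p_W(x)²] / ε²` — "we can guarantee that `Δ ≤ ε` with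
high probability" once `ℓ ≈ (1/γ) log(1/ε)`, under the anti-concentration ASSUMPTION (not asserted).
[cite: AharonovEtAl2023, §3.1 (last paragraph: "Δ ≤ ε with high probability")] -/
theorem card_frame_l1TruncError_ge_mul_sq_le (r : ℝ) (hr0 : 0 ≤ r) (hr1 : r ≤ 1) (ℓ : ℕ) {d : ℕ}
    (U : Fin d → Matrix (ι → Bool) (ι → Bool) ℂ) {ρ : Matrix (ι → Bool) (ι → Bool) ℂ} (hρ : ρᴴ = ρ)
    {ε : ℝ} (hε : 0 ≤ ε) :
    ((Finset.univ.filter fun W : Fin (d + 1) → ι → Pauli => ε ≤ l1TruncError r ℓ U ρ W).card : ℝ) *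
        ε ^ 2 ≤
      (2 : ℝ) ^ Fintype.card ι * (((1 - r) ^ 2) ^ (ℓ + 1) *
        ∑ W : Fin (d + 1) → ι → Pauli, ∑ x : ι → Bool,
          ‖noisyValue 0 (frameLayers U W) ρ (frameObs (proj x) W)‖ ^ 2) := by
  refine le_trans ?_ (sum_frame_l1TruncError_sq_le r hr0 hr1 ℓ U hρ)
  rw [← nsmul_eq_mul, ← Finset.sum_const]
  calc ∑ _W ∈ Finset.univ.filter (fun W : Fin (d + 1) → ι → Pauli => ε ≤ l1TruncError r ℓ U ρ W), ε ^ 2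
      ≤ ∑ W ∈ Finset.univ.filter (fun W : Fin (d + 1) → ι → Pauli => ε ≤ l1TruncError r ℓ U ρ W),
          l1TruncError r ℓ U ρ W ^ 2 :=
        Finset.sum_le_sum fun W hW => pow_le_pow_left₀ hε (Finset.mem_filter.1 hW).2 2
    _ ≤ ∑ W : Fin (d + 1) → ι → Pauli, l1TruncError r ℓ U ρ W ^ 2 :=
        Finset.sum_le_univ_sum_of_nonneg fun W => by positivity

end PauliPath

end Literature.Computability.QuantumComplexity
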